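import Mathlib
import Literature.Geometry.DiscreteGeometry.KissingPatterns
import Summits.AtomisticToContinuum.Crystallization.Theorems.DisclinationRationFiveFoldRationStubPoleLemmaCore
import Summits.AtomisticToContinuum.Crystallization.Theorems.DisclinationRationFiveFoldRationStubShellMutualAux

/-!
# Crux `DisclinationRation.FiveFoldRation` (stmt-AtomisticToContinuum-15799), line `Sketch` —
# stub `stub_dr5_shellMutual`: Shell symmetry and gap structure (front end 1), v2 (capture-free)

For an everywhere-alphabet-good `δ`-separated relatively dense `S ⊆ ℝ³` and `z` in the first
shell of `y` (`0 < |z−y| < 13/10·d_y`): `d_y ≤ |z−y| ≤ 21/20·d_y`, and `y` lies in the first shell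
of `z` with `|y−z| ≤ 21/20·d_z`.

Proof.  A `1/20`-matching of the shell `T_y` (scale `d_y`) with a pattern of unit vectors that is
`1`-separated and `1/2`-covering (all three patterns are: `…StubShellMutualAux`) gives the GAP
STRUCTURE (`dr5sm_cons`): shell points lie in `[d_y, 21/20·d_y]` from `y`, two shell points are
`≥ 9/10·d_y` apart, and in every direction `v` some shell point `u` has `⟪u - y, v⟫ ≥ 9/20·d_y`.
Symmetry: if `z ∈ T_y` but `y ∉ T_z`, i.e. `a := |y - z| ≥ 13/10·d_z`, the shell point `u` of `z`
in the direction of `y` has `|u - y|² ≤ (21/20·d_z)² - 9/10·a·d_z + a² < a²`, so `u ∈ T_y`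
(`a ≤ 21/20·d_y < 13/10·d_y`, and `u ≠ y` as `y ∉ T_z`); but then `9/10·d_y ≤ |u - z| ≤ 21/20·d_z ≤
(21/20)(10/13)·a ≤ (21/20)²(10/13)·d_y < 9/10·d_y`, a contradiction.

`stub_dr5_shellMutual_verbatim` is the statement with the crux's inline predicates written out
(exactly the hypothesis of `stub_dr5_poleLemma_verbatim`); the registered `let`-abbreviated form
`stub_dr5_shellMutual` is definitionally equal and closes by `exact`.
-/

noncomputable section

namespace Summit.AtomisticToContinuum.Crystallization.Theorems

open Literature.Geometry.DiscreteGeometry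

/-! ### Gap structure from a matching -/

/-- **Gap structure from a matching.** If the set `T` is matched, after recentring at `y` and
rescaling by `d⁻¹`, within `1/20` to `A '' P` for a linear isometry `A` and a pattern `P` of unit
vectors that is `1`-separated and `1/2`-covering (`∀ v` unit, `∃ w ∈ P`, `⟪v, w⟫ ≥ 1/2`), then:
every point of `T` is within `21/20·d` of `y`; two points of `T` are `≥ 9/10·d` apart; and in
every direction `v` some `u ∈ T` has `⟪u - y, v⟫ ≥ 9/20·d`. -/
theorem dr5sm_cons {E : Type*} [NormedAddCommGroup E] [InnerProductSpace ℝ E]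
    [FiniteDimensional ℝ E] {P : E → Prop} (hP1 : ∀ x, P x → ‖x‖ = 1)
    (hP2 : ∀ x x', P x → P x' → x ≠ x' → 1 ≤ dist x x')
    (hP3 : ∀ v : E, ‖v‖ = 1 → ∃ w, P w ∧ (1 / 2 : ℝ) ≤ inner ℝ v w)
    {T : Set E} {y : E} {d : ℝ} (hd : 0 < d) (A : E →ₗᵢ[ℝ] E) (e : ↥T ≃ {x // P x})
    (he : ∀ t : ↥T, dist (d⁻¹ • ((t : E) - y)) (A (e t : E)) ≤ 1 / 20) :
    (∀ t ∈ T, dist t y ≤ 21 / 20 * d) ∧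
      (∀ t ∈ T, ∀ t' ∈ T, t ≠ t' → 9 / 10 * d ≤ dist t t') ∧
      ∀ v : E, ‖v‖ = 1 → ∃ u ∈ T, 9 / 20 * d ≤ inner ℝ (u - y) v := by
  refine ⟨fun t ht => ?_, fun t ht t' ht' hne => ?_, fun v hv => ?_⟩
  · have h1 := he ⟨t, ht⟩
    have hn : ‖A (e ⟨t, ht⟩ : E)‖ = 1 := by rw [A.norm_map]; exact hP1 _ (e ⟨t, ht⟩).2
    have h2 : ‖d⁻¹ • (t - y)‖ ≤ 1 / 20 + 1 := by
      calc ‖d⁻¹ • (t - y)‖ = ‖(d⁻¹ • (t - y) - A (e ⟨t, ht⟩ : E)) + A (e ⟨t, ht⟩ : E)‖ := by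
            rw [sub_add_cancel]
        _ ≤ ‖d⁻¹ • (t - y) - A (e ⟨t, ht⟩ : E)‖ + ‖A (e ⟨t, ht⟩ : E)‖ := norm_add_le _ _
        _ ≤ 1 / 20 + 1 := by rw [← dist_eq_norm, hn]; exact add_le_add h1 le_rfl
    rw [norm_smul, norm_inv, Real.norm_of_nonneg hd.le, ← dist_eq_norm, inv_mul_le_iff₀ hd] at h2
    linarith
  · have himg : dist (e ⟨t, ht⟩ : E) (e ⟨t', ht'⟩ : E) ≤ d⁻¹ * dist t t' + 1 / 10 := by
      have h1 : dist (d⁻¹ • (t - y)) (d⁻¹ • (t' - y)) = d⁻¹ * dist t t' := by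
        rw [dist_smul₀, Real.norm_of_nonneg (inv_pos.2 hd).le, dist_sub_right]
      have h2 := A.dist_map (e ⟨t, ht⟩ : E) (e ⟨t', ht'⟩ : E)
      have h3 := dist_triangle4 (A (e ⟨t, ht⟩ : E)) (d⁻¹ • (t - y)) (d⁻¹ • (t' - y))
        (A (e ⟨t', ht'⟩ : E))
      have h4 := he ⟨t, ht⟩
      have h5 := he ⟨t', ht'⟩
      rw [dist_comm] at h4
      linarith
    have hne' : ((e ⟨t, ht⟩ : {x // P x}) : E) ≠ ((e ⟨t', ht'⟩ : {x // P x}) : E) := by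
      intro h
      have := e.injective (Subtype.ext h)
      exact hne (congrArg Subtype.val this)
    have h1 := hP2 _ _ (e ⟨t, ht⟩).2 (e ⟨t', ht'⟩).2 hne'
    have h2 : 9 / 10 ≤ d⁻¹ * dist t t' := by linarith
    rw [le_inv_mul_iff₀ hd] at h2
    linarith
  · obtain ⟨v', hv'⟩ := (A.toLinearIsometryEquiv rfl).surjective v
    rw [LinearIsometry.coe_toLinearIsometryEquiv] at hv'
    subst hv'
    rw [A.norm_map] at hv
    obtain ⟨w, hw, hvw⟩ := hP3 v' hv
    set t : ↥T := e.symm ⟨w, hw⟩ with ht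
    have hte : ((e t : {x // P x}) : E) = w := by simp [t]
    refine ⟨t, t.2, ?_⟩
    have h1 := he t
    rw [hte, dist_eq_norm] at h1
    have h2 : inner ℝ ((t : E) - y) (A v') = d * inner ℝ (d⁻¹ • ((t : E) - y)) (A v') := by
      rw [real_inner_smul_left, ← mul_assoc, mul_inv_cancel₀ hd.ne', one_mul]
    have h3 : inner ℝ (d⁻¹ • ((t : E) - y)) (A v') =
        inner ℝ w v' + inner ℝ (d⁻¹ • ((t : E) - y) - A w) (A v') := by
      rw [inner_sub_left, A.inner_map_map]; ring
    have h4 : |inner ℝ (d⁻¹ • ((t : E) - y) - A w) (A v')| ≤ 1 / 20 :=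
      calc |inner ℝ (d⁻¹ • ((t : E) - y) - A w) (A v')|
          ≤ ‖d⁻¹ • ((t : E) - y) - A w‖ * ‖A v'‖ := abs_real_inner_le_norm _ _
        _ ≤ 1 / 20 * 1 := by
          rw [A.norm_map, hv]; exact mul_le_mul_of_nonneg_right h1 zero_le_one
        _ = 1 / 20 := by norm_num
    have h5 : (1 / 2 : ℝ) ≤ inner ℝ w v' := by rwa [real_inner_comm]
    have h6 := neg_le_of_abs_le h4
    rw [h2, h3]
    nlinarith

/-- The gap structure at an alphabet-good site: the three alternatives fcc / hcp / `Deca` of the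
crux's `GA`, each fed to `dr5sm_cons` with the corresponding covering property. -/
theorem dr5sm_good_cons {T : Set (EuclideanSpace ℝ (Fin 3))} {y : EuclideanSpace ℝ (Fin 3)} {d : ℝ}
    (hd : 0 < d)
    (h : ∃ A : EuclideanSpace ℝ (Fin 3) →ₗᵢ[ℝ] EuclideanSpace ℝ (Fin 3),
      (∃ e : ↥T ≃ ↥fccKissingPattern,
        ∀ t : ↥T, dist (d⁻¹ • (t.1 - y)) (A (e t).1) ≤ 1 / 20) ∨
      (∃ e : ↥T ≃ ↥hcpKissingPattern,
        ∀ t : ↥T, dist (d⁻¹ • (t.1 - y)) (A (e t).1) ≤ 1 / 20) ∨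
      (∃ e : ↥T ≃ ↥{p : EuclideanSpace ℝ (Fin 3) | p = !₂[(0 : ℝ), 0, 1] ∨ p = !₂[(0 : ℝ), 0, -1] ∨
        ∃ k : Fin 5, ∃ σ : ℝ, (σ = 1 / 2 ∨ σ = -(1 / 2)) ∧
          p = !₂[Real.sqrt 3 / 2 * Real.cos (2 * Real.pi * (k : ℝ) / 5),
            Real.sqrt 3 / 2 * Real.sin (2 * Real.pi * (k : ℝ) / 5), σ]},
        ∀ t : ↥T, dist (d⁻¹ • (t.1 - y)) (A (e t).1) ≤ 1 / 20)) :
    (∀ t ∈ T, dist t y ≤ 21 / 20 * d) ∧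
      (∀ t ∈ T, ∀ t' ∈ T, t ≠ t' → 9 / 10 * d ≤ dist t t') ∧
      ∀ v : EuclideanSpace ℝ (Fin 3), ‖v‖ = 1 → ∃ u ∈ T, 9 / 20 * d ≤ inner ℝ (u - y) v := by
  obtain ⟨A, ⟨e, he⟩ | ⟨e, he⟩ | ⟨e, he⟩⟩ := h
  · exact dr5sm_cons (fun x hx => norm_eq_one_of_mem_fccKissingPattern hx)
      (fun x x' hx hx' hne => one_le_dist_of_mem_fccKissingPattern hx hx' hne) dr5sm_fcc_cover
      hd A e he
  · exact dr5sm_cons (fun x hx => norm_eq_one_of_mem_hcpKissingPattern hx)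
      (fun x x' hx hx' hne => one_le_dist_of_mem_hcpKissingPattern hx hx' hne) dr5sm_hcp_cover
      hd A e he
  · exact dr5sm_cons dr5sm_deca_norm dr5sm_deca_sep dr5sm_deca_cover hd A e he

/-! ### The stub -/

/-- Shell symmetry and gap structure, with the crux's inline predicates written out (this is
verbatim the hypothesis of `stub_dr5_poleLemma_verbatim`): for `S` `δ`-separated and everywhere
alphabet-good, `y ∈ S` and `z ∈ S \ {y}` with `dist z y < 13/10·d_y`:
`d_y ≤ dist z y ≤ 21/20·d_y`, `dist y z < 13/10·d_z` and `dist y z ≤ 21/20·d_z`. -/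
theorem stub_dr5_shellMutual_verbatim : (∀ δ : ℝ, 0 < δ → ∀ S : Set (EuclideanSpace ℝ (Fin 3)), (∀ y ∈ S, ∀ z ∈ S, y ≠ z → δ ≤ dist y z) → (∃ R₁ : ℝ, ∀ p : EuclideanSpace ℝ (Fin 3), ∃ y ∈ S, dist y p ≤ R₁) → (∀ y ∈ S, (let d : ℝ := sInf ((fun z => dist z y) '' (S \ {y})); let T : Set (EuclideanSpace ℝ (Fin 3)) := {z : EuclideanSpace ℝ (Fin 3) | z ∈ S ∧ z ≠ y ∧ dist z y < 13 / 10 * d}; ∃ A : EuclideanSpace ℝ (Fin 3) →ₗᵢ[ℝ] EuclideanSpace ℝ (Fin 3), (∃ e : ↥T ≃ ↥Literature.Geometry.DiscreteGeometry.fccKissingPattern, ∀ t : ↥T, dist (d⁻¹ • ((t : EuclideanSpace ℝ (Fin 3)) - y)) (A ((e t : ↥Literature.Geometry.DiscreteGeometry.fccKissingPattern) : EuclideanSpace ℝ (Fin 3))) ≤ 1 / 20) ∨ (∃ e : ↥T ≃ ↥Literature.Geometry.DiscreteGeometry.hcpKissingPattern, ∀ t : ↥T, dist (d⁻¹ • ((t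 : EuclideanSpace ℝ (Fin 3)) - y)) (A ((e t : ↥Literature.Geometry.DiscreteGeometry.hcpKissingPattern) : EuclideanSpace ℝ (Fin 3))) ≤ 1 / 20) ∨ (∃ e : ↥T ≃ ↥{p : EuclideanSpace ℝ (Fin 3) | p = !₂[(0 : ℝ), 0, 1] ∨ p = !₂[(0 : ℝ), 0, -1] ∨ ∃ k : Fin 5, ∃ σ : ℝ, (σ = 1 / 2 ∨ σ = -(1 / 2)) ∧ p = !₂[Real.sqrt 3 / 2 * Real.cos (2 * Real.pi * (k : ℝ) / 5), Real.sqrt 3 / 2 * Real.sin (2 * Real.pi * (k : ℝ) / 5), σ]}, ∀ t : ↥T, dist (d⁻¹ • ((t : EuclideanSpace ℝ (Fin 3)) - y)) (A ((e t : ↥{p : EuclideanSpace ℝ (Fin 3) | p = !₂[(0 : ℝ), 0, 1] ∨ p = !₂[(0 : ℝ), 0, -1] ∨ ∃ k : Fin 5, ∃ σ : ℝ, (σ = 1 / 2 ∨ σ = -(1 / 2)) ∧ p = !₂[Real.sqrt 3 / 2 * Real.cos (2 * Real.pi * (k : ℝ) / 5), Real.sqrt 3 / 2 * Real.sin (2 *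 Real.pi * (k : ℝ) / 5), σ]}) : EuclideanSpace ℝ (Fin 3))) ≤ 1 / 20))) → ∀ y ∈ S, ∀ z ∈ S, z ≠ y → dist z y < 13 / 10 * sInf ((fun z => dist z y) '' (S \ {y})) → sInf ((fun z => dist z y) '' (S \ {y})) ≤ dist z y ∧ dist z y ≤ 21 / 20 * sInf ((fun z => dist z y) '' (S \ {y})) ∧ dist y z < 13 / 10 * sInf ((fun w => dist w z) '' (S \ {z})) ∧ dist y z ≤ 21 / 20 * sInf ((fun w => dist w z) '' (S \ {z}))) := by
  intro δ hδ S hsep _ hgood y hy z hz hzy hlt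
  -- nearest-neighbour distances: `d ≤ dist` and `δ ≤ d`
  have hinf : ∀ y' w, w ∈ S → w ≠ y' →
      sInf ((fun x => dist x y') '' (S \ {y'})) ≤ dist w y' := fun y' w hw hne =>
    csInf_le ⟨0, by rintro _ ⟨x, -, rfl⟩; exact dist_nonneg⟩ ⟨w, ⟨hw, hne⟩, rfl⟩
  have hδle : ∀ y' w, y' ∈ S → w ∈ S → w ≠ y' →
      δ ≤ sInf ((fun x => dist x y') '' (S \ {y'})) := by
    intro y' w hy' hw hne
    refine le_csInf ⟨_, ⟨w, ⟨hw, hne⟩, rfl⟩⟩ ?_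
    rintro _ ⟨x, ⟨hxS, hxy⟩, rfl⟩
    show δ ≤ dist x y'
    rw [dist_comm]
    exact hsep y' hy' x hxS (fun h => hxy h.symm)
  have hdy : 0 < sInf ((fun x => dist x y) '' (S \ {y})) := lt_of_lt_of_le hδ (hδle y z hy hz hzy)
  have hdz : 0 < sInf ((fun x => dist x z) '' (S \ {z})) :=
    lt_of_lt_of_le hδ (hδle z y hz hy hzy.symm)
  obtain ⟨hY1, hY2, -⟩ := dr5sm_good_cons hdy (hgood y hy)
  obtain ⟨hZ1, -, hZ3⟩ := dr5sm_good_cons hdz (hgood z hz)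
  have hzT : z ∈ {x | x ∈ S ∧ x ≠ y ∧
      dist x y < 13 / 10 * sInf ((fun x => dist x y) '' (S \ {y}))} := ⟨hz, hzy, hlt⟩
  have hb : dist z y ≤ 21 / 20 * sInf ((fun x => dist x y) '' (S \ {y})) := hY1 z hzT
  have hyz : dist y z = dist z y := dist_comm y z
  -- symmetry of the shell relation
  have hc : dist y z < 13 / 10 * sInf ((fun x => dist x z) '' (S \ {z})) := by
    by_contra hcon
    push Not at hcon
    have ha0 : 0 < dist y z := dist_pos.2 hzy.symm
    have hv : ‖(dist y z)⁻¹ • (y - z)‖ = 1 := by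
      rw [norm_smul, norm_inv, Real.norm_of_nonneg dist_nonneg, ← dist_eq_norm,
        inv_mul_cancel₀ ha0.ne']
    obtain ⟨u, huT, hu⟩ := hZ3 _ hv
    have hub : dist u z ≤ 21 / 20 * sInf ((fun x => dist x z) '' (S \ {z})) := hZ1 u huT
    have hinner : 9 / 20 * sInf ((fun x => dist x z) '' (S \ {z})) * dist y z ≤
        inner ℝ (u - z) (y - z) := by
      have h1 : inner ℝ (u - z) (y - z) =
          dist y z * inner ℝ (u - z) ((dist y z)⁻¹ • (y - z)) := by
        rw [real_inner_smul_right, ← mul_assoc, mul_inv_cancel₀ ha0.ne', one_mul]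
      rw [h1]
      nlinarith
    have hexp : dist u y ^ 2 = dist u z ^ 2 - 2 * inner ℝ (u - z) (y - z) + dist y z ^ 2 := by
      rw [dist_eq_norm, dist_eq_norm, dist_eq_norm, ← norm_sub_sq_real, sub_sub_sub_cancel_right]
    have huy_lt : dist u y < dist y z := by
      have hsq : dist u y ^ 2 < dist y z ^ 2 := by
        nlinarith [mul_self_le_mul_self dist_nonneg hub, mul_pos hdz hdz, mul_pos hdz ha0,
          mul_nonneg hdz.le (sub_nonneg.2 hcon)]
      exact lt_of_pow_lt_pow_left₀ 2 dist_nonneg hsq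
    have huy : u ≠ y := by
      rintro rfl
      exact absurd huT.2.2 (not_lt.2 hcon)
    have huTy : u ∈ {x | x ∈ S ∧ x ≠ y ∧
        dist x y < 13 / 10 * sInf ((fun x => dist x y) '' (S \ {y}))} :=
      ⟨huT.1, huy, by linarith⟩
    have hsepY := hY2 u huTy z hzT huT.2.1
    linarith
  exact ⟨hinf y z hz hzy, hb, hc, hZ1 y ⟨hy, hzy.symm, hc⟩⟩

/-- For an everywhere-alphabet-good `δ`-separated relatively dense `S ⊆ ℝ³` and `z` in the first shell of `y` (`0 < |z−y| < 13/10·d_y`): `d_y ≤ |z−y| ≤ 21/20·d_y`, and `y` lies in the first shell of `z` with `|y−z| ≤ 21/20·d_z`. Statement in the registered `let`-abbreviated style (`Dc` decahedral pattern, `nd S y = d_y`, `Sh S y = T_y`, `F`/`H`/`Tol` = fcc/hcp/deca matchings), definitionally equal to the crux's inline predicates. -/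
theorem stub_dr5_shellMutual : (let Dc := {p : EuclideanSpace ℝ (Fin 3) | p = !₂[(0 : ℝ), 0, 1] ∨ p = !₂[(0 : ℝ), 0, -1] ∨ ∃ k : Fin 5, ∃ σ : ℝ, (σ = 1 / 2 ∨ σ = -(1 / 2)) ∧ p = !₂[Real.sqrt 3 / 2 * Real.cos (2 * Real.pi * (k : ℝ) / 5), Real.sqrt 3 / 2 * Real.sin (2 * Real.pi * (k : ℝ) / 5), σ]}; let nd := fun (S : Set (EuclideanSpace ℝ (Fin 3))) (y : EuclideanSpace ℝ (Fin 3)) => sInf ((fun z => dist z y) '' (S \ {y})); let Sh := fun (S : Set (EuclideanSpace ℝ (Fin 3))) (y : EuclideanSpace ℝ (Fin 3)) => {z : EuclideanSpace ℝ (Fin 3) | z ∈ S ∧ z ≠ y ∧ dist z y < 13 / 10 * nd S y}; let F := fun (S : Set (EuclideanSpace ℝ (Fin 3))) (y : EuclideanSpace ℝ (Fin 3)) (A : EuclideanSpace ℝ (Fin 3) →ₗᵢ[ℝ] EuclideanSpace ℝ (Fin 3)) => ∃ e : ↥(Sh S y) ≃ ↥Literature.Geometry.DiscreteGeometry.fccKissingPattern,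 ∀ t : ↥(Sh S y), dist ((nd S y)⁻¹ • (t.1 - y)) (A (e t).1) ≤ 1 / 20; let H := fun (S : Set (EuclideanSpace ℝ (Fin 3))) (y : EuclideanSpace ℝ (Fin 3)) (A : EuclideanSpace ℝ (Fin 3) →ₗᵢ[ℝ] EuclideanSpace ℝ (Fin 3)) => ∃ e : ↥(Sh S y) ≃ ↥Literature.Geometry.DiscreteGeometry.hcpKissingPattern, ∀ t : ↥(Sh S y), dist ((nd S y)⁻¹ • (t.1 - y)) (A (e t).1) ≤ 1 / 20; let Tol := fun (S : Set (EuclideanSpace ℝ (Fin 3))) (y : EuclideanSpace ℝ (Fin 3)) (A : EuclideanSpace ℝ (Fin 3) →ₗᵢ[ℝ] EuclideanSpace ℝ (Fin 3)) (e : ↥(Sh S y) ≃ ↥Dc) => ∀ t : ↥(Sh S y), dist ((nd S y)⁻¹ • (t.1 - y)) (A (e t).1) ≤ 1 / 20; ∀ δ : ℝ, 0 < δ → ∀ S : Set (EuclideanSpace ℝ (Fin 3)), (∀ y ∈ S, ∀ z ∈ S, y ≠ z → δ ≤ dist y z) → (∃ R₁ : ℝ, ∀ p : EuclideanSpace ℝ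 (Fin 3), ∃ y ∈ S, dist y p ≤ R₁) → (∀ y ∈ S, ∃ A : EuclideanSpace ℝ (Fin 3) →ₗᵢ[ℝ] EuclideanSpace ℝ (Fin 3), F S y A ∨ H S y A ∨ ∃ e : ↥(Sh S y) ≃ ↥Dc, Tol S y A e) → ∀ y ∈ S, ∀ z ∈ S, z ≠ y → dist z y < 13 / 10 * nd S y → nd S y ≤ dist z y ∧ dist z y ≤ 21 / 20 * nd S y ∧ dist y z < 13 / 10 * nd S z ∧ dist y z ≤ 21 / 20 * nd S z) := by
  exact stub_dr5_shellMutual_verbatim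

end Summit.AtomisticToContinuum.Crystallization.Theorems

end
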